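import Mathlib
import HarnessLib
import Summits.QuantumFields.YangMills.Theses.PencilRigidity
import Summits.QuantumFields.YangMills.Theorems.PencilRigidityCurvatureKernelBoundOffDiagonalVanishing
import Literature.Analysis.FunctionSpaces.SchwartzPolyKernel

/-!
# `CurvatureKernelBound` — stub R `LocalRepresentation` (support for stmt-QuantumFields-11687, line `sixteen-charts-analytic-kernel`, skeleton v11)

Tensor representation ⇒ local representation near a configuration (TensorRegularity + pinning, as in `exists_nhds_apply_eq_zero`).

Let `T` be a continuous functional on `𝓢((ℝ⁴)², ℂ)`, `K` a kernel continuous on an open set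
`W ⊆ ℝ⁴`, and `z = (z₀, z₁)`, `r > 0` with `B(z₀, r) - B(z₁, r) ⊆ W`, such that
`T (f ⊗ g) = ∫ K(x₀ - x₁) (f ⊗ g)` for all complex tensors with `supp f ⊆ B(z₀, r)`,
`supp g ⊆ B(z₁, r)`. Then `T F = ∫ K(x₀ - x₁) F` for every test function `F` supported in a small
open box about `z`. Proof: the truncated kernel `K̃ = 1_{B̄(z, r/2)} K(x₀ - x₁)` is bounded and
measurable, so `L F = ∫ K̃ F` is a continuous functional
(`Literature.Analysis.FunctionSpaces.exists_clm_integral_mul`); `Λ = T - L` kills all complex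
tensors supported in `B(z₀, r/2) × B(z₁, r/2)`, hence (`TensorRegularity`, order `0`, standard
frame) is represented near `z` by a continuous local kernel, which vanishes by
`kernel_eq_zero_on_box`; so `T F = L F = ∫ K(x₀ - x₁) F` near `z`.
-/

noncomputable section

open scoped BigOperators Topology SchwartzMap ComplexConjugate InnerProductSpace
open MeasureTheory Filter Set Metric
open Literature.MathematicalPhysics.QuantumLattice Literature.MathematicalPhysics.AQFT
open Literature.MathematicalPhysics.QuantumFieldTheory

namespace Summit.QuantumFields.YangMills.Theorems.CurvatureKernel

/-- Coordinates of a point of a closed ball of `(ℝ⁴)²` (sup metric) lie in the coordinate closed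
balls. [folklore] -/
theorem apply_mem_closedBall_of_mem_closedBall {z x : Fin 2 → (EuclideanSpace ℝ (Fin 4))} {s : ℝ}
    (hx : x ∈ closedBall z s) (i : Fin 2) : x i ∈ closedBall (z i) s :=
  mem_closedBall.2 ((dist_le_pi_dist x z i).trans (mem_closedBall.1 hx))

/-- **Truncated difference kernel.** If `K` is continuous on an open `W ⊇ B(z₀, r) - B(z₁, r)`, the
truncation `K̃ = 1_{B̄(z, r/2)} K(x₀ - x₁)` is integration against a continuous functional `L` on
`𝓢((ℝ⁴)², ℂ)`, with `K̃ F` integrable for every Schwartz `F` (`K̃` is measurable and bounded: the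
box `B̄(z, r/2)` is compact and `x ↦ K(x₀ - x₁)` is continuous on it). [folklore] -/
theorem exists_clm_truncatedKernel (K : (EuclideanSpace ℝ (Fin 4)) → ℂ) (W : Set (EuclideanSpace ℝ (Fin 4)))
    (hK : ContinuousOn K W) (z : Fin 2 → (EuclideanSpace ℝ (Fin 4))) {r : ℝ} (hr : 0 < r)
    (hzW : ∀ x y : (EuclideanSpace ℝ (Fin 4)), x ∈ ball (z 0) r → y ∈ ball (z 1) r → x - y ∈ W) :
    ∃ L : 𝓢((Fin 2 → (EuclideanSpace ℝ (Fin 4))), ℂ) →L[ℂ] ℂ,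
      ∀ F : 𝓢((Fin 2 → (EuclideanSpace ℝ (Fin 4))), ℂ),
        Integrable (fun x => (closedBall z (r / 2)).indicator
          (fun x : Fin 2 → (EuclideanSpace ℝ (Fin 4)) => K (x 0 - x 1)) x * F x) ∧
        L F = ∫ x, (closedBall z (r / 2)).indicator
          (fun x : Fin 2 → (EuclideanSpace ℝ (Fin 4)) => K (x 0 - x 1)) x * F x := by
  have hcb : ∀ i : Fin 2, closedBall (z i) (r / 2) ⊆ ball (z i) r := fun i =>
    closedBall_subset_ball (by linarith)
  -- continuity of `x ↦ K (x 0 - x 1)` on the compact box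
  have hKc : ContinuousOn (fun x : Fin 2 → (EuclideanSpace ℝ (Fin 4)) => K (x 0 - x 1))
      (closedBall z (r / 2)) :=
    hK.comp ((continuous_apply 0).sub (continuous_apply 1)).continuousOn fun x hx =>
      hzW _ _ (hcb 0 (apply_mem_closedBall_of_mem_closedBall hx 0))
        (hcb 1 (apply_mem_closedBall_of_mem_closedBall hx 1))
  obtain ⟨C, hC⟩ := (isCompact_closedBall z (r / 2)).exists_bound_of_continuousOn hKc
  have hmeas : AEStronglyMeasurable ((closedBall z (r / 2)).indicator
      (fun x : Fin 2 → (EuclideanSpace ℝ (Fin 4)) => K (x 0 - x 1))) volume :=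
    (aestronglyMeasurable_indicator_iff measurableSet_closedBall).2
      (hKc.aestronglyMeasurable measurableSet_closedBall)
  have hle : ∀ x : Fin 2 → (EuclideanSpace ℝ (Fin 4)), ‖(closedBall z (r / 2)).indicator
      (fun x : Fin 2 → (EuclideanSpace ℝ (Fin 4)) => K (x 0 - x 1)) x‖ ≤ max C 0 * (1 + ‖x‖) ^ 0 := by
    intro x
    rw [pow_zero, mul_one]
    by_cases hx : x ∈ closedBall z (r / 2)
    · rw [Set.indicator_of_mem hx]
      exact (hC x hx).trans (le_max_left _ _)
    · rw [Set.indicator_of_notMem hx, norm_zero]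
      exact le_max_right _ _
  obtain ⟨L, hL⟩ := Literature.Analysis.FunctionSpaces.exists_clm_integral_mul (μ := volume) hmeas hle
  exact ⟨L, fun F => ⟨Literature.Analysis.FunctionSpaces.integrable_mul_of_norm_le_pow hmeas hle F, hL F⟩⟩

/-- **Stub `LocalRepresentation`** (registered signature verbatim). `Λ := T − (F ↦ ∫ K(x₀−x₁) 1_{box} F)` is a CLM killing the complex tensors supported in the balls; `TensorRegularity` (order 0, standard frame) represents `Λ` near `z` by a continuous local kernel, which vanishes by `kernel_eq_zero_on_box`. [folklore] -/
theorem LocalRepresentation : open Literature.MathematicalPhysics.QuantumLattice Literature.MathematicalPhysics.AQFT Literature.MathematicalPhysics.QuantumFieldTheory in ∀ (T : SchwartzMap (Fin 2 → (EuclideanSpace ℝ (Fin 4))) ℂ →L[ℂ] ℂ) (K : (EuclideanSpace ℝ (Fin 4)) → ℂ) (W : Set (EuclideanSpace ℝ (Fin 4))), IsOpen W → ContinuousOn K W → ∀ (z : Fin 2 → (EuclideanSpace ℝ (Fin 4))) (r : ℝ), 0 < r → (∀ x y : (EuclideanSpace ℝ (Fin 4)), x ∈ Metric.ball (z 0) r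 → y ∈ Metric.ball (z 1) r → x - y ∈ W) → (∀ (f g : SchwartzMap (EuclideanSpace ℝ (Fin 4)) ℂ), tsupport (f : (EuclideanSpace ℝ (Fin 4)) → ℂ) ⊆ Metric.ball (z 0) r → tsupport (g : (EuclideanSpace ℝ (Fin 4)) → ℂ) ⊆ Metric.ball (z 1) r → ∀ F : SchwartzMap (Fin 2 → (EuclideanSpace ℝ (Fin 4))) ℂ, IsTensorOf F ![f, g] → MeasureTheory.Integrable (fun x : Fin 2 → (EuclideanSpace ℝ (Fin 4)) => K (x 0 - x 1) * F x) ∧ T F = ∫ x : Fin 2 → (EuclideanSpace ℝ (Fin 4)), K (x 0 - x 1) * F x) → ∃ O : Set (Fin 2 → (EuclideanSpace ℝ (Fin 4))), IsOpen O ∧ z ∈ O ∧ ∀ F : SchwartzMap (Fin 2 → (EuclideanSpace ℝ (Fin 4))) ℂ, tsupport (F : (Fin 2 → (EuclideanSpace ℝ (Fin 4))) → ℂ) ⊆ O → MeasureTheory.Integrable (fun x : Fin 2 → (EuclideanSpace ℝ (Fin 4)) => K (x 0 - x 1) * F x) ∧ T F = ∫ x : Fin 2 → (EuclideanSpace ℝ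 (Fin 4)), K (x 0 - x 1) * F x := by
  intro T K W _hW hK z r hr hzW hT
  have hr2 : 0 < r / 2 := half_pos hr
  -- the truncated kernel and its functional
  obtain ⟨L, hL⟩ := exists_clm_truncatedKernel K W hK z hr hzW
  -- pointwise agreement of the truncated and the true integrand on functions supported in the box
  have hagree : ∀ F : 𝓢((Fin 2 → (EuclideanSpace ℝ (Fin 4))), ℂ),
      tsupport (F : (Fin 2 → (EuclideanSpace ℝ (Fin 4))) → ℂ) ⊆ closedBall z (r / 2) →
      (fun x : Fin 2 → (EuclideanSpace ℝ (Fin 4)) => K (x 0 - x 1) * F x) =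
        fun x => (closedBall z (r / 2)).indicator
          (fun x : Fin 2 → (EuclideanSpace ℝ (Fin 4)) => K (x 0 - x 1)) x * F x := by
    intro F hF
    funext x
    by_cases hx : x ∈ closedBall z (r / 2)
    · rw [Set.indicator_of_mem hx]
    · rw [image_eq_zero_of_notMem_tsupport fun h => hx (hF h), mul_zero, mul_zero]
  -- `Λ = T - L` kills the complex tensors supported in `B(z₀, r/2) × B(z₁, r/2)`
  have hΛ0 : ∀ f g : 𝓢((EuclideanSpace ℝ (Fin 4)), ℂ),
      tsupport (f : (EuclideanSpace ℝ (Fin 4)) → ℂ) ⊆ ball (z 0) (r / 2) →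
      tsupport (g : (EuclideanSpace ℝ (Fin 4)) → ℂ) ⊆ ball (z 1) (r / 2) →
      ∀ F : 𝓢((Fin 2 → (EuclideanSpace ℝ (Fin 4))), ℂ), IsTensorOf F ![f, g] → (T - L) F = 0 := by
    intro f g hf hg F hF
    obtain ⟨-, hTF⟩ := hT f g (hf.trans (ball_subset_ball (by linarith)))
      (hg.trans (ball_subset_ball (by linarith))) F hF
    have hsupp : tsupport (F : (Fin 2 → (EuclideanSpace ℝ (Fin 4))) → ℂ) ⊆ closedBall z (r / 2) := by
      intro x hx
      have h := hF.tsupport_subset hx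
      rw [mem_closedBall, dist_pi_le_iff hr2.le]
      intro i
      fin_cases i
      · exact mem_closedBall.1 (ball_subset_closedBall (hf (h 0)))
      · exact mem_closedBall.1 (ball_subset_closedBall (hg (h 1)))
    rw [sub_apply, hTF, (hL F).2, hagree F hsupp, sub_self]
  -- a local kernel for `Λ` from `TensorRegularity` (standard frame, order `0`)
  obtain ⟨N₁, ρ, B, hρ, hreg⟩ := TensorRegularity _ (EuclideanSpace.basisFun (Fin 4) ℝ).orthonormal.linearIndependent
    (ball (z 0) (r / 2)) (ball (z 1) (r / 2)) isOpen_ball isOpen_ball (z 0) (z 1)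
    (mem_ball_self hr2) (mem_ball_self hr2) 0
  obtain ⟨K₂, hK₂c, -, hK₂rep⟩ := hreg (T - L) (by
    intro j N _ f g hf hg F hF
    have h0 : (T - L) F = 0 := by
      rcases hF with hF | hF
      · exact hΛ0 _ _ ((tsupport_iterate_lineDerivOp_subset _ N f).trans hf) hg F hF
      · exact hΛ0 _ _ hf ((tsupport_iterate_lineDerivOp_subset _ N g).trans hg) F hF
    rw [h0, norm_zero]
    exact mul_nonneg (schwartzNorm_nonneg _ _) (schwartzNorm_nonneg _ _))
  -- the small box
  set ρ' : ℝ := min ρ (r / 2) with hρ'def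
  have hρ' : 0 < ρ' := lt_min hρ hr2
  set O : Set (Fin 2 → (EuclideanSpace ℝ (Fin 4))) := {x | x 0 ∈ ball (z 0) ρ' ∧ x 1 ∈ ball (z 1) ρ'} with hOdef
  have hOW : O ⊆ {x | x 0 ∈ ball (z 0) ρ ∧ x 1 ∈ ball (z 1) ρ} := fun x hx =>
    ⟨ball_subset_ball (min_le_left _ _) hx.1, ball_subset_ball (min_le_left _ _) hx.2⟩
  have hOB : O ⊆ closedBall z (r / 2) := by
    intro x hx
    rw [mem_closedBall, dist_pi_le_iff hr2.le]
    intro i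
    fin_cases i
    · exact mem_closedBall.1 (ball_subset_closedBall (ball_subset_ball (min_le_right _ _) hx.1))
    · exact mem_closedBall.1 (ball_subset_closedBall (ball_subset_ball (min_le_right _ _) hx.2))
  have hOopen : IsOpen O :=
    ((isOpen_ball (x := z 0) (ε := ρ')).preimage
      (continuous_apply 0 : Continuous fun x : Fin 2 → (EuclideanSpace ℝ (Fin 4)) => x 0)).and
      ((isOpen_ball (x := z 1) (ε := ρ')).preimage
        (continuous_apply 1 : Continuous fun x : Fin 2 → (EuclideanSpace ℝ (Fin 4)) => x 1))
  -- the local kernel vanishes on the small box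
  have hK₂0 : ∀ w : Fin 2 → (EuclideanSpace ℝ (Fin 4)), w 0 ∈ ball (z 0) ρ' → w 1 ∈ ball (z 1) ρ' → K₂ w = 0 := by
    refine kernel_eq_zero_on_box (hK₂c.mono hOW) fun φ ψ hφ hψ => ?_
    have htφ : tsupport (ofRealTest φ : (EuclideanSpace ℝ (Fin 4)) → ℂ) ⊆ ball (z 0) ρ' :=
      (tsupport_comp_subset (g := fun r : ℝ => (r : ℂ)) Complex.ofReal_zero _).trans hφ
    have htψ : tsupport (ofRealTest ψ : (EuclideanSpace ℝ (Fin 4)) → ℂ) ⊆ ball (z 1) ρ' :=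
      (tsupport_comp_subset (g := fun r : ℝ => (r : ℂ)) Complex.ofReal_zero _).trans hψ
    have hsuppF : tsupport (SchwartzMap.tensorFin 2 ![ofRealTest φ, ofRealTest ψ] :
        (Fin 2 → (EuclideanSpace ℝ (Fin 4))) → ℂ) ⊆ O :=
      (tsupport_tensorFin_two_subset_prod _ _).trans fun x hx => ⟨htφ hx.1, htψ hx.2⟩
    obtain ⟨hint, hrep⟩ := hK₂rep _ (hsuppF.trans hOW)
    refine ⟨hint, ?_⟩
    rw [← hrep]
    exact hΛ0 _ _ (htφ.trans (ball_subset_ball (min_le_right _ _)))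
      (htψ.trans (ball_subset_ball (min_le_right _ _))) _ (isTensorOf_tensorFin _)
  refine ⟨O, hOopen, ⟨mem_ball_self hρ', mem_ball_self hρ'⟩, fun F hF => ?_⟩
  -- `Λ F = ∫ K₂ F = 0`, so `T F = L F = ∫ K̃ F = ∫ K (x 0 - x 1) F`
  obtain ⟨-, hrep⟩ := hK₂rep F (hF.trans hOW)
  have hΛF : (T - L) F = 0 := by
    rw [hrep]
    refine integral_eq_zero_of_ae (Eventually.of_forall fun x => ?_)
    by_cases hx : x ∈ O
    · simp [hK₂0 x hx.1 hx.2]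
    · simp [image_eq_zero_of_notMem_tsupport fun h => hx (hF h)]
  rw [sub_apply, sub_eq_zero] at hΛF
  rw [hagree F (hF.trans hOB), hΛF]
  exact hL F

end Summit.QuantumFields.YangMills.Theorems.CurvatureKernel

end
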